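import Summits.QuantumFields.YangMills.Theorems.BalabanUVNodesN18KingModelOneRun
import Summits.QuantumFields.YangMills.Theorems.BalabanUVNodesN18KingModelLineReadouts

/-!
# BalabanUVNodes ∕ N18 — (0.25) IN KING'S MODEL, READ-OUT FORMS: King's one-run decay PER LINE in block distance, the one-run
# envelopes `DecayBound` of configuration-dependent read-outs on the END's carriers `torusCarriers` ∕ `reFunctional` (and in the
# END's complex currency), and FINE LINES OVER BLOCK PAIRS (Track A, DAG node N18 = NE5 `T4OutputRate.NE5 EA EB W κ θ C₅` :211;
# director-ym R134 row n18 s3 «King-model transfer `N18KingModelTorus` (κ, C₅ from (d, L, a, m², γ)) → `TwoRunTorusNE5Final*`»,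
# module 5b of seat pub-ymgap-dag-n18-e; 5a = `N18KingModelOneRun`, 5c = `N18KingModelFinePoints`)

HONEST FRAMING.  Count-neutral kernel bookkeeping (seat pub-ymgap-dag-n18-e g5, strategy s3; `--supports` K3′
`SpineGivenEndpointR12`, helper).  King's `A = 0` scalar MODEL ([King1986], printed and proved, typed by seats n18-a∕n18-b) —
NOT Bałaban's covariant one-step outputs `E^{(j)}(X; g, U_k(V))` of [Balaban1987RG1] (0.24)∕(2.13), for which NE5 is NOT IN
PRINT and has no tree producer (NODE O instance 0∕1); NOT a node discharge; finite tori; nothing continuum ∕ ℝ⁴ ∕ OS ∕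
mass-gap ∕ Clay.  THEOREMS ONLY: 0 `def`, 0 `sorry`, standard axioms.

THE POINT.  Module 5a (`N18KingModelOneRun.decayBound_kingModel_threeFactor_torus`) typed the one-run envelope (0.25)
`|E(X)| ≤ A e^{−κ d X}` WITH `κ > 0` for King's ACTUAL (4.42) three-factor graphs on any carriers.  THIS FILE carries it to the
two read-out layers of the polymer representation of modules 4a∕4b (p469937∕p470068), which typed only the two-run side:
* §3 (per line, d general) **`abs_kingGraph_le_of_readings`** — the one-run twin of p469937 §3 `abs_kingGraph_sub_le_of_readings`:
  `∃ κ > 0, A ≥ 0` ((d, L, a, m²) only) with `|G_A(l)|, |G_B(l)| ≤ A·e^{−κ|B(x_A l) − B(y_A l)|_{T₁}}` for ANY index type of lines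
  `l` with King scale `s_l ≥ 1` and run-A readings under run-B readings (5a §2 on line-indexed carriers).
* §4 (the END's carriers) **`decayBound_reFunctional_of_fieldLocated`** ∕ **`norm_readout_le_of_fieldLocated`** ∕
  **`decayBound_reFunctional_of_fieldCubePairs`** — the one-run twins of p469937 §2: a configuration-dependent read-out
  `K⟨j,X⟩ φ` located uniformly in `φ` gives `DecayBound (reFunctional N W fun j X φ => K⟨j,X⟩ φ) W′ A κ′` on `torusCarriers N W`
  and, in the END's own complex currency, `‖E j X φ‖ ≤ A e^{−κ′ d_j(X)}` — LITERALLY the `hA1`∕`hB1` slots of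
  `TwoRunTorusNE5.ne5_of_torus_rates_all_scales` and the `hE0`∕`hE1` slots of `TwoRunTorusNE5Final8.ne5_end_final_all8`; sums
  over all pairs of cubes of located line contributions cost half the exponent (`N18EndCarriersLineSums.polyTreeLoss_le`,
  `card_pairs_le_of_tdom`, (2.30) lower half).
* §5 (generic) **`abs_sum_fibre_mul_le`** — FINE LINES OVER BLOCK PAIRS: for a block map `blk : ι → T` on a finite type of
  fine lines, test weights `w` with `Σ_{blk i = t} |w i| ≤ 1` (block-ℓ¹-normalised — King's fields live on the fine lattice
  and (3.73) is a `sup` over `x′ ∈ B^n(x)`, p. 664) and a bound `|f i| ≤ B` on the fibre give `|Σ_{blk i = t} w i·f i| ≤ B`;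
  with Mathlib's `Finset.sum_fiberwise` this is all module 5c needs to read King's graphs at EVERY fine point instead of the
  blocks' base points (p470068 «WHAT THIS DOES NOT DO»; referee dag-ref-F READ-64 GAP-STATED «fine-point multiplicity»).
WHAT THIS DOES NOT DO.  `A = 0`, `g`∕`U` unread; periodic b.c.; King's (2.20)-rescaling factor and vertex functions outside;
NOT Bałaban's `E^{(j)}(X; g, U)`.

Sources: C. King, Commun. Math. Phys. **102** (1986) 649–677 [King1986] — Thm 3.3 (3.7) p. 658, (4.34) p. 674, (4.41)–(4.42)
p. 675, Prop. 3.9 (3.73) p. 665, p. 664 («x′ ∈ B^n(x)»); T. Bałaban, Commun. Math. Phys. **109** (1987) 249–301 [Balaban1987RG1]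
— (0.24)–(0.25) p. 257, (1.18) p. 263; **116** (1988) 1–22 [Balaban1988RG2Cluster] (2.30) p. 18.  No claim about the mass gap.
-/

noncomputable section

namespace Summit.QuantumFields.YangMills.BalabanUVNodes.N18KingModelOneRunReadouts

open Real Matrix
open Literature.MathematicalPhysics.QuantumFieldTheory.Balaban1983to89
open Literature.MathematicalPhysics.QuantumFieldTheory.Balaban1983to89.T4OutputRate (Carriers Functional NE5 DecayBound)
open Literature.MathematicalPhysics.QuantumFieldTheory.Balaban1983to89.B5Prop11Plancherel (Tor fine)
open Literature.MathematicalPhysics.QuantumFieldTheory.Balaban1983to89.TreeLengthTorus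
  (TPt TDom torusTreeLen torusTreeLen_nonneg tsys)
open Literature.MathematicalPhysics.QuantumFieldTheory.Balaban1983to89.B13Lemma3Torus (TwoTorusStep)
open Literature.MathematicalPhysics.QuantumFieldTheory.King1986 (aK)
open Literature.MathematicalPhysics.QuantumFieldTheory.King1986.Torus
  (minimiser effLaplacian blockProj blockOf tdistT tdistT_nonneg)
open Summit.QuantumFields.BalabanUV.T4Continuum.Spine.NE5.TwoRunTorusNE5 (torusCarriers reFunctional)
open Summit.QuantumFields.YangMills.BalabanUVNodes.N18KingModelOneRun (decayBound_kingModel_threeFactor_torus)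
open Summit.QuantumFields.YangMills.BalabanUVNodes.N18EndCarriersLineSums
  (polyTreeLoss_le polyTreeLoss_const_pos card_pairs_le_of_tdom)

/-! ## §3 (0.25) PER LINE, in block distance (d general) -/

section PerLine
variable {d : ℕ}

/-- **KING'S ONE-RUN DECAY FOR THE (4.42) THREE-FACTOR GRAPHS, LINE BY LINE, IN BLOCK DISTANCE** (the one-run twin of p469937
`abs_kingGraph_sub_le_of_readings`).  For `d ≥ 1`, odd `L > 1`, `a > 0`, `m² > 0` there are `κ > 0`, `A ≥ 0` — functions of
`d, L, a, m²` ONLY (the letters of §2) — such that for every `n ≥ 1`, every family of unit tori `L·M_k(μ) = 2L^{m_k}`, every index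
type of LINES `l` with King scale `s_l ≥ 1` and readings of run-A fine points `x_A l, y_A l` UNDER run B's `x_B l, y_B l`, and
every line `l`: BOTH runs' graphs are bounded by `A·e^{−κ·|B(x_A l) − B(y_A l)|_{T₁}}` —
`|Σ_{z,w} ℋ_s(x_A l, z)·C^{(s)}(z, w)·ℋ_s(y_A l, w)| ≤ A·e^{−κ|B(x_A l) − B(y_A l)|}` and the same for
`Σ_{z,w} ℋ_{s+n}(x_B l, z)·C^{(s+n)}(z, w)·ℋ_{s+n}(y_B l, w)` (`ℋ = minimiser`, `C^{(·)} = (effLaplacian + aL⁻²·blockProj)⁻¹`, King's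
ACTUAL `A = 0` operators).  §2 on the carriers `{Dom := lines, scale := s, d := block distance, backgrounds := PUnit,
transport := id}`, window `univ`, coupling `1`. [cite: King1986, Thm 3.3 (3.7) p.658, (4.34) p.674, (4.41)–(4.42) p.675; Balaban1987RG1, (0.25) p.257] -/
theorem abs_kingGraph_le_of_readings (hd : 1 ≤ d) (L : ℕ) [NeZero L] (hLp : Odd L ∧ 1 < L) {a m2 : ℝ}
    (ha : 0 < a) (hm : 0 < m2) :
    ∃ κ A : ℝ, 0 < κ ∧ 0 ≤ A ∧
      ∀ (n : ℕ) (_hn : 1 ≤ n) (M : ℕ → Fin d → ℕ) [∀ k μ, NeZero (M k μ)]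
        (_hM : ∀ k, ∃ mm : ℕ, ∀ μ, L * M k μ = 2 * L ^ mm)
        (ι : Type) (s : ι → ℕ) (_hs : ∀ l, 1 ≤ s l)
        (xA yA : (l : ι) → Tor (fine (L ^ s l) (fine L (M (s l)))))
        (xB yB : (l : ι) → Tor (fine (L ^ n * L ^ s l) (fine L (M (s l)))))
        (_hx : ∀ l μ, (xA l μ).val = (xB l μ).val / L ^ n)
        (_hy : ∀ l μ, (yA l μ).val = (yB l μ).val / L ^ n) (l : ι),
        |(fun z => minimiser (L ^ s l) (fine L (M (s l))) (aK a L (s l)) (((L ^ s l : ℕ) : ℝ) ^ 2) m2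
              (Pi.single z 1) (xA l))
            ⬝ᵥ ((effLaplacian (L ^ s l) (fine L (M (s l))) (aK a L (s l)) (((L ^ s l : ℕ) : ℝ) ^ 2) m2
                  + (a * ((L : ℝ) ^ 2)⁻¹) • blockProj L (M (s l)))⁻¹
                *ᵥ fun w => minimiser (L ^ s l) (fine L (M (s l))) (aK a L (s l)) (((L ^ s l : ℕ) : ℝ) ^ 2) m2
                    (Pi.single w 1) (yA l))|
            ≤ A * Real.exp (-(κ * tdistT (fine L (M (s l)))
              (blockOf (L ^ s l) (fine L (M (s l))) (xA l)) (blockOf (L ^ s l) (fine L (M (s l))) (yA l)))) ∧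
        |(fun z => minimiser (L ^ n * L ^ s l) (fine L (M (s l))) (aK a L (s l + n))
              (((L ^ n * L ^ s l : ℕ) : ℝ) ^ 2) m2 (Pi.single z 1) (xB l))
            ⬝ᵥ ((effLaplacian (L ^ n * L ^ s l) (fine L (M (s l))) (aK a L (s l + n))
                    (((L ^ n * L ^ s l : ℕ) : ℝ) ^ 2) m2
                  + (a * ((L : ℝ) ^ 2)⁻¹) • blockProj L (M (s l)))⁻¹
                *ᵥ fun w => minimiser (L ^ n * L ^ s l) (fine L (M (s l))) (aK a L (s l + n))
                    (((L ^ n * L ^ s l : ℕ) : ℝ) ^ 2) m2 (Pi.single w 1) (yB l))|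
            ≤ A * Real.exp (-(κ * tdistT (fine L (M (s l)))
              (blockOf (L ^ s l) (fine L (M (s l))) (xA l)) (blockOf (L ^ s l) (fine L (M (s l))) (yA l)))) := by
  obtain ⟨κ, A, hκ, hA, H⟩ := decayBound_kingModel_threeFactor_torus hd L hLp ha hm
  refine ⟨κ, A, hκ, hA, ?_⟩
  intro n hn M _ hM ι s hs xA yA xB yB hx hy l
  -- the LINE-indexed carriers: King's scale `s l`, tree length = the block distance of the line's run-A readings
  let C' : Carriers :=
    { Dom := ι, scale := s,
      d := fun l => tdistT (fine L (M (s l))) (blockOf (L ^ s l) (fine L (M (s l))) (xA l))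
        (blockOf (L ^ s l) (fine L (M (s l))) (yA l)),
      d_nonneg := fun l => tdistT_nonneg _ _ _,
      BgA := PUnit, BgB := PUnit, gauge := fun _ _ => 0, gauge_nonneg := fun _ _ => le_rfl, transport := id }
  have h := H n hn M hM C' hs xA yA xB yB hx hy (fun _ => le_rfl)
    (fun _ _ l => (fun z => minimiser (L ^ s l) (fine L (M (s l))) (aK a L (s l)) (((L ^ s l : ℕ) : ℝ) ^ 2) m2
        (Pi.single z 1) (xA l))
      ⬝ᵥ ((effLaplacian (L ^ s l) (fine L (M (s l))) (aK a L (s l)) (((L ^ s l : ℕ) : ℝ) ^ 2) m2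
            + (a * ((L : ℝ) ^ 2)⁻¹) • blockProj L (M (s l)))⁻¹
          *ᵥ fun w => minimiser (L ^ s l) (fine L (M (s l))) (aK a L (s l)) (((L ^ s l : ℕ) : ℝ) ^ 2) m2
              (Pi.single w 1) (yA l)))
    (fun _ _ l => (fun z => minimiser (L ^ n * L ^ s l) (fine L (M (s l))) (aK a L (s l + n))
        (((L ^ n * L ^ s l : ℕ) : ℝ) ^ 2) m2 (Pi.single z 1) (xB l))
      ⬝ᵥ ((effLaplacian (L ^ n * L ^ s l) (fine L (M (s l))) (aK a L (s l + n))
              (((L ^ n * L ^ s l : ℕ) : ℝ) ^ 2) m2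
            + (a * ((L : ℝ) ^ 2)⁻¹) • blockProj L (M (s l)))⁻¹
          *ᵥ fun w => minimiser (L ^ n * L ^ s l) (fine L (M (s l))) (aK a L (s l + n))
              (((L ^ n * L ^ s l : ℕ) : ℝ) ^ 2) m2 (Pi.single w 1) (yB l)))
    (fun _ _ _ => rfl) (fun _ _ _ => rfl) Set.univ
  exact ⟨h.1 (fun _ => 1) (Set.mem_univ _) PUnit.unit l, h.2 (fun _ => 1) (Set.mem_univ _) PUnit.unit l⟩

end PerLine

/-! ## §4 (0.25) for configuration-dependent read-outs on the END's carriers -/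

section FieldReadouts
variable {L' : ℕ} [NeZero L']

/-- **LOCATED CONFIGURATION-DEPENDENT READ-OUTS CARRY (0.25) ON THE END'S CARRIERS** (the one-run twin of p469937
`ne5_reFunctional_of_fieldLocated`).  A real family `K⟨j,X⟩ φ` on `Σ_j 𝐃_j` depending on the scale-`j` configuration, located
uniformly in `φ` — `|K⟨j,X⟩ φ| ≤ A·e^{−κ′·d_j(X)}` — read through `TwoRunTorusNE5.reFunctional` as the genuine functional
`E j X φ = K⟨j,X⟩ φ` (real part on the space `(W j).sp2 X`, `0` off it) satisfies `DecayBound (reFunctional N W E) W′ A κ′` on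
`torusCarriers N W` for every window `W′` — the carriers and read-out of `TwoRunTorusNE5Final8.ne5_end_final_all8`.
[cite: Balaban1987RG1, (0.25) p.257, (1.18) p.263] -/
theorem decayBound_reFunctional_of_fieldLocated (N : ℕ → ℕ) [∀ j, NeZero (N j)]
    (W : (j : ℕ) → TwoTorusStep 4 L' (N j)) (K : (X : Σ j : ℕ, TDom 4 (N j)) → (W X.1).Φ → ℝ) {κ' A : ℝ}
    (hA : 0 ≤ A)
    (hK : ∀ (X : Σ j : ℕ, TDom 4 (N j)) (φ : (W X.1).Φ), |K X φ| ≤ A * Real.exp (-(κ' * torusTreeLen X.2.1)))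
    (W' : Set (ℕ → ℝ)) :
    DecayBound (C := torusCarriers N W) (reFunctional N W fun j X φ => ((K ⟨j, X⟩ φ : ℝ) : ℂ)) W' A κ' := by
  intro g _ U X
  obtain ⟨j, X⟩ := X
  show |reFunctional N W (fun j X φ => ((K ⟨j, X⟩ φ : ℝ) : ℂ)) g U ⟨j, X⟩|
    ≤ A * Real.exp (-(κ' * (tsys 4 (N j)).dj X))
  by_cases hφ : U j ∈ (W j).sp2 X
  · simp only [reFunctional, hφ, if_true, Complex.ofReal_re]
    exact hK ⟨j, X⟩ (U j)
  · simp only [reFunctional, hφ, if_false, abs_zero]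
    positivity

/-- **The same in the END's own complex currency** — the `hA1`∕`hB1` slots of `TwoRunTorusNE5.ne5_of_torus_rates_all_scales`
and the `hE0`∕`hE1` slots of `TwoRunTorusNE5Final8.ne5_end_final_all8` (`‖E j X φ‖ ≤ A·e^{−κ′·d_j(X)}` on the space): for the
real read-out `E j X φ = K⟨j,X⟩ φ` they hold at every configuration, on or off the space. [cite: Balaban1987RG1, (0.25) p.257] -/
theorem norm_readout_le_of_fieldLocated (N : ℕ → ℕ) [∀ j, NeZero (N j)]
    (W : (j : ℕ) → TwoTorusStep 4 L' (N j)) (K : (X : Σ j : ℕ, TDom 4 (N j)) → (W X.1).Φ → ℝ) {κ' A : ℝ}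
    (hK : ∀ (X : Σ j : ℕ, TDom 4 (N j)) (φ : (W X.1).Φ), |K X φ| ≤ A * Real.exp (-(κ' * torusTreeLen X.2.1))) :
    ∀ (j : ℕ) (X : TDom 4 (N j)) (φ : (W j).Φ), φ ∈ (W j).sp2 X →
      ‖(((K ⟨j, X⟩ φ : ℝ) : ℂ))‖ ≤ A * Real.exp (-(κ' * (tsys 4 (N j)).dj X)) := by
  intro j X φ _
  rw [Complex.norm_real, Real.norm_eq_abs]
  exact hK ⟨j, X⟩ φ

/-- **THE «ALL PAIRS OF CUBES» READING, CONFIGURATION-DEPENDENT, CARRIES (0.25) AT THE END'S CARRIERS** (the one-run twin of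
p469937 `ne5_reFunctional_of_fieldCubePairs`).  If a configuration-dependent read-out is at each domain `⟨j, X⟩` and configuration
`φ` the sum over ALL pairs `(p, q)` of cubes of `X` of line contributions located at `X` uniformly in `φ` —
`|G X φ (p,q)| ≤ A·e^{−κ·d_j(X)}` (`κ > 0`, `A ≥ 0`; pairs not so located are to be given `G = 0`) — then
`DecayBound (reFunctional … K) W′ (A·(4·2^4)²·(2!(2∕κ)²e^{κ∕2})) (κ∕2)`: the `(4·2^4)²(d_j(X) + 1)²` lines of a domain
(`N18EndCarriersLineSums.card_pairs_le_of_tdom`, (2.30) lower half) cost half the exponent (`polyTreeLoss_le`).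
[cite: Balaban1987RG1, (0.25) p.257, (1.18) p.263; Balaban1988RG2Cluster, (2.30) p.18] -/
theorem decayBound_reFunctional_of_fieldCubePairs (N : ℕ → ℕ) [∀ j, NeZero (N j)]
    (W : (j : ℕ) → TwoTorusStep 4 L' (N j)) (K : (X : Σ j : ℕ, TDom 4 (N j)) → (W X.1).Φ → ℝ)
    (G : (X : Σ j : ℕ, TDom 4 (N j)) → (W X.1).Φ → TPt 4 (N X.1) × TPt 4 (N X.1) → ℝ)
    {κ A : ℝ} (hκ : 0 < κ) (hA : 0 ≤ A)
    (hK : ∀ X φ, K X φ = ∑ pq ∈ X.2.1 ×ˢ X.2.1, G X φ pq)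
    (hG : ∀ X φ, ∀ pq ∈ X.2.1 ×ˢ X.2.1, |G X φ pq| ≤ A * Real.exp (-(κ * torusTreeLen X.2.1)))
    (W' : Set (ℕ → ℝ)) :
    DecayBound (C := torusCarriers N W) (reFunctional N W fun j X φ => ((K ⟨j, X⟩ φ : ℝ) : ℂ)) W'
      (A * (4 * 2 ^ 4) ^ 2 * (((2 : ℕ).factorial : ℝ) * (2 / κ) ^ 2 * Real.exp (κ / 2))) (κ / 2) := by
  have hBpos := polyTreeLoss_const_pos hκ 2
  refine decayBound_reFunctional_of_fieldLocated N W K (by positivity) (fun X φ => ?_) W'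
  have ht : 0 ≤ torusTreeLen X.2.1 := torusTreeLen_nonneg _
  have hB := polyTreeLoss_le hκ 2 ht
  have hP : (((X.2.1 ×ˢ X.2.1).card : ℕ) : ℝ) ≤ (4 * 2 ^ 4) ^ 2 * (torusTreeLen X.2.1 + 1) ^ 2 :=
    card_pairs_le_of_tdom X.2
  calc |K X φ| = |∑ pq ∈ X.2.1 ×ˢ X.2.1, G X φ pq| := by rw [hK X φ]
    _ ≤ ∑ pq ∈ X.2.1 ×ˢ X.2.1, |G X φ pq| := Finset.abs_sum_le_sum_abs _ _
    _ ≤ ∑ _pq ∈ X.2.1 ×ˢ X.2.1, A * Real.exp (-(κ * torusTreeLen X.2.1)) := Finset.sum_le_sum (hG X φ)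
    _ = (X.2.1 ×ˢ X.2.1).card * (A * Real.exp (-(κ * torusTreeLen X.2.1))) := by
        rw [Finset.sum_const, nsmul_eq_mul]
    _ ≤ (4 * 2 ^ 4) ^ 2 * (torusTreeLen X.2.1 + 1) ^ 2 * (A * Real.exp (-(κ * torusTreeLen X.2.1))) :=
        mul_le_mul_of_nonneg_right hP (by positivity)
    _ = (4 * 2 ^ 4) ^ 2 * A * ((torusTreeLen X.2.1 + 1) ^ 2 * Real.exp (-(κ * torusTreeLen X.2.1))) := by ring
    _ ≤ (4 * 2 ^ 4) ^ 2 * A * ((((2 : ℕ).factorial : ℝ) * (2 / κ) ^ 2 * Real.exp (κ / 2))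
          * Real.exp (-(κ / 2 * torusTreeLen X.2.1))) :=
        mul_le_mul_of_nonneg_left hB (by positivity)
    _ = A * (4 * 2 ^ 4) ^ 2 * (((2 : ℕ).factorial : ℝ) * (2 / κ) ^ 2 * Real.exp (κ / 2))
          * Real.exp (-(κ / 2 * torusTreeLen X.2.1)) := by ring

end FieldReadouts

/-! ## §5 Fine lines over block pairs (generic) -/

section FineLines
variable {ι T : Type*} [Fintype ι] [DecidableEq T]

/-- **FINE LINES OVER A BLOCK PAIR.**  Fine lines `i` (pairs of fine points of run B's torus) are grouped by a block map
`blk : ι → T` (the pair of unit blocks containing them); block-ℓ¹-normalised test weights — `Σ_{blk i = t} |w i| ≤ 1` — and a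
bound `|f i| ≤ B` on the fibre of `t` give `|Σ_{blk i = t} w i·f i| ≤ B`: a block-averaged insertion reads King's kernels at
EVERY fine point of the two blocks at the price of the base-point reading (King's `sup` over `x′ ∈ B^n(x)`, p. 664).
[cite: King1986, p.664 and Prop. 3.9 (3.73) p.665] -/
theorem abs_sum_fibre_mul_le (blk : ι → T) (t : T) {w f : ι → ℝ} {B : ℝ} (hB : 0 ≤ B)
    (hw : ∑ i ∈ Finset.univ.filter (fun i => blk i = t), |w i| ≤ 1)
    (hf : ∀ i, blk i = t → |f i| ≤ B) :
    |∑ i ∈ Finset.univ.filter (fun i => blk i = t), w i * f i| ≤ B := by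
  calc |∑ i ∈ Finset.univ.filter (fun i => blk i = t), w i * f i|
      ≤ ∑ i ∈ Finset.univ.filter (fun i => blk i = t), |w i * f i| := Finset.abs_sum_le_sum_abs _ _
    _ ≤ ∑ i ∈ Finset.univ.filter (fun i => blk i = t), |w i| * B := by
        refine Finset.sum_le_sum fun i hi => ?_
        rw [abs_mul]
        exact mul_le_mul_of_nonneg_left (hf i (Finset.mem_filter.1 hi).2) (abs_nonneg _)
    _ = (∑ i ∈ Finset.univ.filter (fun i => blk i = t), |w i|) * B := by rw [Finset.sum_mul]
    _ ≤ 1 * B := mul_le_mul_of_nonneg_right hw hB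
    _ = B := one_mul B

/-- **Resummation over fine lines** (Mathlib's `Finset.sum_fiberwise`, recorded in the shape module 5c uses): summing the
fibre sums over ALL block pairs gives the sum over all fine lines — (0.24)'s «every line exactly once» one layer down.
[cite: Balaban1987RG1, (0.24) p.257] -/
theorem sum_fibre_eq_sum [Fintype T] (blk : ι → T) (g : ι → ℝ) :
    ∑ t, ∑ i ∈ Finset.univ.filter (fun i => blk i = t), g i = ∑ i, g i :=
  Finset.sum_fiberwise Finset.univ blk g

/-- **Locality over fine lines**: the fibre sums over a SET of block pairs `s` are the sum over the fine lines whose block pair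
lies in `s` (Mathlib's `Finset.sum_fiberwise_eq_sum_filter`). [cite: Balaban1987RG1, (0.24) p.257] -/
theorem sum_fibre_eq_sum_filter (blk : ι → T) (s : Finset T) (g : ι → ℝ) :
    ∑ t ∈ s, ∑ i ∈ Finset.univ.filter (fun i => blk i = t), g i = ∑ i ∈ Finset.univ.filter (fun i => blk i ∈ s), g i :=
  Finset.sum_fiberwise_eq_sum_filter Finset.univ s blk g

end FineLines

end Summit.QuantumFields.YangMills.BalabanUVNodes.N18KingModelOneRunReadouts

end
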